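import Literature.NumberTheory.LFunctions.ZetaScrewGrowthMomentsProofs
import HarnessLib

/-!
# Suzuki (2023), Thm 11.1: discharge of `Suzuki2023_thm111`

LABEL: RH-FREE theorem about the graded family `Ψ_ω` (the statement at `ω = 0` is
RH-EQUIVALENT·PRINTED — "RH ⟺ `Ψ` eventually non-negative" — and is proved here as an
*equivalence*, nothing is asserted about either side); bears_on: B-C/B-P (COLUMN 6, de
Branges–Suzuki corpus, `docs/m5` rh-crit dbl). WHAT THIS IS NOT: proving the equivalence fixes
WHICH sign condition (`Ψ_ω(t) ≥ 0` for large `t`) is equivalent to the quasi-Riemann hypothesis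
"`ξ(s) ≠ 0` for `Re s > 1/2 + ω`"; it does not move RH; nothing here bears on the truth of RH.

**Suzuki2023 Thm 11.1** [cite: Suzuki2023, Thm 11.1, p. 22 (arXiv 2206.03682 p0022:L48–52)]:
"Let `ω ∈ ℝ`. Then `ξ(s) ≠ 0` for `Re(s) > 1/2 + ω` if and only if there exists `t₀ > 0` such
that `Ψ_ω(t)` is non-negative when `t ≥ t₀`."  Here `Ψ_ω = zetaScrewShift ω` ((11.1),
`ZetaScrewGrowthMoments.lean`).  The `⟸` direction is the tree's `Suzuki2023_thm111_mpr`
(`ZetaScrewGrowthMomentsProofs.lean`, §G: (11.2) + Landau's theorem on Dirichlet integrals of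
eventually non-negative functions).  This file proves the `⟹` direction and assembles
`Suzuki2023_thm111_holds : Suzuki2023_thm111`.

## The printed proof of `⟹` and this formalisation

Printed (p. 22, before Thm 11.1): "the expansion `Im[i(ξ'/ξ)(s+ω)] = Σ_ρ (Re(s+ω) − Re ρ)/|s+ω−ρ|²`
shows that `i(ξ'/ξ)(1/2+ω−iz)` belongs to the class `𝒩` if `ξ(s) ≠ 0` for `Re(s) > 1/2+ω`.
Therefore … `Ψ_ω(t)` is non-negative by (11.2) and [KrLa77] as in the case of `g(t) = −Ψ(t)`."
The Kreĭn–Langer integral representation of screw functions [KrLa77, Satz 5.9] is not in the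
tree.  DEVIATION (a genuinely shorter road over the tree, same mechanism — positivity read off
zero by zero): we use instead the series over the zeros printed on the same page
("the analogs of (1.1) and (1.3) are as follows: `Ψ_ω(t) = Σ_γ (γ²+ω²)^{-2}[ωt(γ²+ω²) + (γ²−ω²)
− e^{−ωt}(γ²−ω²)cos(γt) − e^{−ωt}·2γω sin(γt)]`", p. 22), obtained here by pushing the tree's
zero series for `Ψ` (Thm 1.1 (2), `Suzuki2023_thm11_series_holds`:
`Ψ(u) = Σ_ρ m(ρ)(cosh(κu) − 1)/κ²`, `κ = ρ − 1/2`) through the three terms of (11.1) by dominated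
convergence (`Σ_ρ m(ρ)/|Im ρ|² < ∞`).  In the variable `ρ` the `ρ`-th term of `Ψ_ω(t)` is
`m(ρ)·½[h(κ−ω,t) + h(−κ−ω,t)]`, `h(α,t) := (e^{αt} − 1 − αt)/α² = ∫₀ᵗ (t−u)e^{αu}du`
(`shift_cfun_eq`; an ODE identity: both sides vanish to first order at `t = 0` and have second
derivative `e^{−ωt}cosh(κt)`).  If `ξ ≠ 0` on `Re s > 1/2 + ω` then every zero has
`1/2 − ω ≤ Re ρ ≤ 1/2 + ω` (apply the hypothesis to `ρ` and to `1 − ρ`), i.e. `Re(±κ − ω) ≤ 0`,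
and for `Re α ≤ 0`, `Im α ≠ 0`, `t ≥ 0` one has `Re h(α,t) ≥ 0` (`re_hfun_nonneg`) — Pólya's
mechanism (`(t−u)⁺e^{Re α·u}` is convex decreasing), proved here by the SAME identity read
backwards: `Re h(−δ+iτ,t) = e^{−δt}c(t) + 2δ∫₀ᵗe^{−δu}c(u)du + δ²∫₀ᵗ(t−u)e^{−δu}c(u)du` with
`c(u) = (1 − cos τu)/τ² ≥ 0`.  Hence `Ψ_ω(t) = Σ_ρ m(ρ)·½[Re h(κ−ω,t) + Re h(−κ−ω,t)] ≥ 0` for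
every `t > 0` (`zetaScrewShift_nonneg_of_riemannXi_ne_zero`; by evenness for all real `t`) —
slightly more than the printed "for `t ≥ t₀`", exactly as the printed sentence before Thm 11.1
says ("the function `Ψ_ω(t)` is non-negative").

## Contents

* §A calculus of the shift functional `k ↦ e^{−ωt}k(t) + 2ω∫₀ᵗe^{−ωu}k + ω²∫₀ᵗ(t−u)e^{−ωu}k`
  (written out, no new definitions): first and second derivative, a uniqueness lemma, and the
  identity `shift_cfun_eq`.
* §B `re_hfun_nonneg`.
* §C `hasSum_zetaScrewShift`: the zero series of `Ψ_ω(t)`, `t > 0` (p. 22).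
* §D `zetaScrewShift_nonneg_of_riemannXi_ne_zero` (Thm 11.1 `⟹`, all `t`),
  `Suzuki2023_thm111_mp`, and the discharge `Suzuki2023_thm111_holds`.

D-0026: no new `def … : Prop`; helpers are proved (mostly `private`) lemmas. [cite: Suzuki2023, §11, p. 22]
-/

noncomputable section

open Complex MeasureTheory Set Filter Topology
open scoped Real ComplexConjugate

namespace Literature.NumberTheory.LFunctions

namespace Suzuki2023Thm111

/-! ## §A. Calculus of the shift functional -/

/-- `d/ds ∫₀ˢ G = G(s)` for continuous `G`. [folklore] -/
private theorem hasDerivAt_integral_right {G : ℝ → ℂ} (hG : Continuous G) (t : ℝ) :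
    HasDerivAt (fun s : ℝ ↦ ∫ u in (0 : ℝ)..s, G u) (G t) t :=
  intervalIntegral.integral_hasDerivAt_right (hG.intervalIntegrable _ _)
    (hG.stronglyMeasurableAtFilter _ _) hG.continuousAt

/-- `d/ds ∫₀ˢ (s − u) G(u) du = ∫₀ˢ G` for continuous `G`. [folklore] -/
private theorem hasDerivAt_integral_ramp {G : ℝ → ℂ} (hG : Continuous G) (t : ℝ) :
    HasDerivAt (fun s : ℝ ↦ ∫ u in (0 : ℝ)..s, ((s : ℂ) - u) * G u) (∫ u in (0 : ℝ)..t, G u) t := by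
  have e : (fun s : ℝ ↦ ∫ u in (0 : ℝ)..s, ((s : ℂ) - u) * G u) =
      fun s : ℝ ↦ (s : ℂ) * (∫ u in (0 : ℝ)..s, G u) - ∫ u in (0 : ℝ)..s, (u : ℂ) * G u := by
    funext s
    have e1 : ∫ u in (0 : ℝ)..s, ((s : ℂ) - u) * G u =
        ∫ u in (0 : ℝ)..s, ((s : ℂ) * G u - (u : ℂ) * G u) :=
      intervalIntegral.integral_congr fun u _ ↦ by ring
    have hc1 : Continuous fun u : ℝ ↦ (s : ℂ) * G u := by fun_prop
    have hc2 : Continuous fun u : ℝ ↦ (u : ℂ) * G u := by fun_prop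
    rw [e1, intervalIntegral.integral_sub (hc1.intervalIntegrable _ _)
      (hc2.intervalIntegrable _ _), intervalIntegral.integral_const_mul]
  rw [e]
  have h1 : HasDerivAt (fun s : ℝ ↦ (s : ℂ)) 1 t := by
    simpa using (hasDerivAt_id t).ofReal_comp
  have h2 := hasDerivAt_integral_right hG t
  have hc3 : Continuous fun u : ℝ ↦ (u : ℂ) * G u := by fun_prop
  have h3 := hasDerivAt_integral_right hc3 t
  refine ((h1.fun_mul h2).fun_sub h3).congr_deriv ?_
  ring

/-- `d/ds e^{αs} = α e^{αs}` (as a function `ℝ → ℂ`). [folklore] -/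
private theorem hasDerivAt_cexp_mul (α : ℂ) (t : ℝ) :
    HasDerivAt (fun s : ℝ ↦ cexp (α * s)) (α * cexp (α * t)) t := by
  have h1 : HasDerivAt (fun s : ℝ ↦ (s : ℂ)) 1 t := by
    simpa using (hasDerivAt_id t).ofReal_comp
  refine (h1.const_mul α).cexp.congr_deriv ?_
  ring

/-- `d/ds e^{−ωs} = −ω e^{−ωs}` (as a function `ℝ → ℂ`). [folklore] -/
private theorem hasDerivAt_cexp_neg_mul (ω t : ℝ) :
    HasDerivAt (fun s : ℝ ↦ cexp (-((ω : ℂ) * s))) (-(ω : ℂ) * cexp (-((ω : ℂ) * t))) t := by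
  have e : (fun s : ℝ ↦ cexp (-((ω : ℂ) * s))) = fun s : ℝ ↦ cexp (-(ω : ℂ) * s) := by
    funext s; rw [neg_mul]
  rw [e, ← neg_mul]
  exact hasDerivAt_cexp_mul (-(ω : ℂ)) t

/-- Continuity of `u ↦ e^{−ωu} k(u)`. [folklore] -/
private theorem continuous_cexp_neg_mul_mul {ω : ℝ} {k : ℝ → ℂ} (hkc : Continuous k) :
    Continuous fun u : ℝ ↦ cexp (-((ω : ℂ) * u)) * k u :=
  (Complex.continuous_exp.comp (continuous_const.mul continuous_ofReal).neg).mul hkc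

/-- **First derivative of the shift functional** `Φ(s) = e^{−ωs}k(s) + 2ω∫₀ˢe^{−ωu}k(u)du
+ ω²∫₀ˢ(s−u)e^{−ωu}k(u)du`: `Φ'(s) = e^{−ωs}k'(s) + ωe^{−ωs}k(s) + ω²∫₀ˢe^{−ωu}k(u)du`. [folklore] -/
private theorem hasDerivAt_shift {ω : ℝ} {k k' : ℝ → ℂ} (hk : ∀ u, HasDerivAt k (k' u) u)
    (hkc : Continuous k) (t : ℝ) :
    HasDerivAt (fun s : ℝ ↦ cexp (-((ω : ℂ) * s)) * k s +
        2 * (ω : ℂ) * (∫ u in (0 : ℝ)..s, cexp (-((ω : ℂ) * u)) * k u) +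
        (ω : ℂ) ^ 2 * ∫ u in (0 : ℝ)..s, ((s : ℂ) - u) * (cexp (-((ω : ℂ) * u)) * k u))
      (cexp (-((ω : ℂ) * t)) * k' t + (ω : ℂ) * (cexp (-((ω : ℂ) * t)) * k t) +
        (ω : ℂ) ^ 2 * ∫ u in (0 : ℝ)..t, cexp (-((ω : ℂ) * u)) * k u) t := by
  have hE := hasDerivAt_cexp_neg_mul ω t
  have hG := continuous_cexp_neg_mul_mul (ω := ω) hkc
  have h1 := hE.fun_mul (hk t)
  have h2 := (hasDerivAt_integral_right hG t).const_mul (2 * (ω : ℂ))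
  have h3 := (hasDerivAt_integral_ramp hG t).const_mul ((ω : ℂ) ^ 2)
  refine ((h1.fun_add h2).fun_add h3).congr_deriv ?_
  ring

/-- **Second derivative of the shift functional**: `Φ''(s) = e^{−ωs}k''(s)`. [folklore] -/
private theorem hasDerivAt_shift_deriv {ω : ℝ} {k k' k'' : ℝ → ℂ} (hk : ∀ u, HasDerivAt k (k' u) u)
    (hk' : ∀ u, HasDerivAt k' (k'' u) u) (hkc : Continuous k) (t : ℝ) :
    HasDerivAt (fun s : ℝ ↦ cexp (-((ω : ℂ) * s)) * k' s + (ω : ℂ) * (cexp (-((ω : ℂ) * s)) * k s) +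
        (ω : ℂ) ^ 2 * ∫ u in (0 : ℝ)..s, cexp (-((ω : ℂ) * u)) * k u)
      (cexp (-((ω : ℂ) * t)) * k'' t) t := by
  have hE := hasDerivAt_cexp_neg_mul ω t
  have hG := continuous_cexp_neg_mul_mul (ω := ω) hkc
  have h1 := hE.fun_mul (hk' t)
  have h2 := (hE.fun_mul (hk t)).const_mul (ω : ℂ)
  have h3 := (hasDerivAt_integral_right hG t).const_mul ((ω : ℂ) ^ 2)
  refine ((h1.fun_add h2).fun_add h3).congr_deriv ?_
  ring

/-- Uniqueness: two functions `ℝ → ℂ` with the same second derivative and the same value and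
first derivative at `0` coincide. [folklore] -/
private theorem eq_of_hasDerivAt_two {f f' f'' g g' g'' : ℝ → ℂ}
    (hf : ∀ t, HasDerivAt f (f' t) t) (hf' : ∀ t, HasDerivAt f' (f'' t) t)
    (hg : ∀ t, HasDerivAt g (g' t) t) (hg' : ∀ t, HasDerivAt g' (g'' t) t)
    (h2 : ∀ t, f'' t = g'' t) (h0 : f 0 = g 0) (h0' : f' 0 = g' 0) (t : ℝ) : f t = g t := by
  have hd : ∀ s, f' s = g' s := by
    intro s
    have hdiff : Differentiable ℝ (f' - g') := fun x ↦ ((hf' x).sub (hg' x)).differentiableAt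
    have hzero : ∀ x, deriv (f' - g') x = 0 := fun x ↦ by
      rw [((hf' x).sub (hg' x)).deriv, h2 x, sub_self]
    have := is_const_of_deriv_eq_zero hdiff hzero s 0
    simp only [Pi.sub_apply, h0', sub_self] at this
    exact sub_eq_zero.1 this
  have hdiff : Differentiable ℝ (f - g) := fun x ↦ ((hf x).sub (hg x)).differentiableAt
  have hzero : ∀ x, deriv (f - g) x = 0 := fun x ↦ by
    rw [((hf x).sub (hg x)).deriv, hd x, sub_self]
  have := is_const_of_deriv_eq_zero hdiff hzero t 0
  simp only [Pi.sub_apply, h0, sub_self] at this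
  exact sub_eq_zero.1 this

/-- `h(α,s) = (e^{αs} − 1 − αs)/α²` has `h' = (e^{αs} − 1)/α` (`α ≠ 0`). [folklore] -/
private theorem hasDerivAt_hfun {α : ℂ} (hα : α ≠ 0) (t : ℝ) :
    HasDerivAt (fun s : ℝ ↦ (cexp (α * s) - 1 - α * s) / α ^ 2) ((cexp (α * t) - 1) / α) t := by
  have h1 : HasDerivAt (fun s : ℝ ↦ (s : ℂ)) 1 t := by
    simpa using (hasDerivAt_id t).ofReal_comp
  refine ((((hasDerivAt_cexp_mul α t).sub_const 1).fun_sub (h1.const_mul α)).div_const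
    (α ^ 2)).congr_deriv ?_
  rw [div_eq_div_iff (pow_ne_zero 2 hα) hα]
  ring

/-- `h'(α,s) = (e^{αs} − 1)/α` has derivative `e^{αs}` (`α ≠ 0`). [folklore] -/
private theorem hasDerivAt_hfun_deriv {α : ℂ} (hα : α ≠ 0) (t : ℝ) :
    HasDerivAt (fun s : ℝ ↦ (cexp (α * s) - 1) / α) (cexp (α * t)) t := by
  refine (((hasDerivAt_cexp_mul α t).sub_const 1).div_const α).congr_deriv ?_
  exact mul_div_cancel_left₀ _ hα

/-- `c(κ,s) = (cosh(κs) − 1)/κ²` has `c' = sinh(κs)κ/κ²`. [folklore] -/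
private theorem hasDerivAt_cfun (κ : ℂ) (t : ℝ) :
    HasDerivAt (fun s : ℝ ↦ (Complex.cosh (κ * s) - 1) / κ ^ 2)
      (Complex.sinh (κ * t) * κ / κ ^ 2) t := by
  have h1 : HasDerivAt (fun s : ℝ ↦ κ * (s : ℂ)) κ t := by
    simpa using ((hasDerivAt_id t).ofReal_comp).const_mul κ
  have h := (Complex.hasDerivAt_cosh (κ * t)).comp t h1
  have h' : HasDerivAt (fun s : ℝ ↦ Complex.cosh (κ * s)) (Complex.sinh (κ * t) * κ) t := h
  exact (h'.sub_const 1).div_const (κ ^ 2)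

/-- `c'(κ,s) = sinh(κs)κ/κ²` has derivative `cosh(κs)` (`κ ≠ 0`). [folklore] -/
private theorem hasDerivAt_cfun_deriv {κ : ℂ} (hκ : κ ≠ 0) (t : ℝ) :
    HasDerivAt (fun s : ℝ ↦ Complex.sinh (κ * s) * κ / κ ^ 2) (Complex.cosh (κ * t)) t := by
  have h1 : HasDerivAt (fun s : ℝ ↦ κ * (s : ℂ)) κ t := by
    simpa using ((hasDerivAt_id t).ofReal_comp).const_mul κ
  have h := (Complex.hasDerivAt_sinh (κ * t)).comp t h1
  have h' : HasDerivAt (fun s : ℝ ↦ Complex.sinh (κ * s)) (Complex.cosh (κ * t) * κ) t := h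
  refine ((h'.mul_const κ).div_const (κ ^ 2)).congr_deriv ?_
  rw [mul_assoc, ← pow_two, mul_div_assoc, div_self (pow_ne_zero 2 hκ), mul_one]

/-- `e^{−ωs} cosh(κs) = ½(e^{(κ−ω)s} + e^{(−κ−ω)s})`. [folklore] -/
private theorem cexp_neg_mul_cosh (κ : ℂ) (ω s : ℝ) :
    cexp (-((ω : ℂ) * s)) * Complex.cosh (κ * s) =
      cexp ((κ - ω) * s) / 2 + cexp ((-κ - ω) * s) / 2 := by
  rw [Complex.cosh, show (κ - ω) * (s : ℂ) = -((ω : ℂ) * s) + κ * s by ring,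
    show (-κ - ω) * (s : ℂ) = -((ω : ℂ) * s) + -(κ * s) by ring, Complex.exp_add, Complex.exp_add]
  ring

/-- **The shift identity** (an ODE identity; the `ρ`-th term of the series for `Ψ_ω`, p. 22):
for `κ ≠ 0`, real `ω` with `κ − ω ≠ 0 ≠ −κ − ω`, a constant `A`, and every real `t`,
`e^{−ωt}k(t) + 2ω∫₀ᵗe^{−ωu}k(u)du + ω²∫₀ᵗ(t−u)e^{−ωu}k(u)du = A·½[h(κ−ω,t) + h(−κ−ω,t)]`
for `k(u) = A(cosh(κu) − 1)/κ²`, `h(α,t) = (e^{αt} − 1 − αt)/α²`. (Both sides vanish to first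
order at `t = 0` and have second derivative `A e^{−ωt}cosh(κt)`.)
[cite: Suzuki2023, §11, p. 22 (series for Ψ_ω, "analogs of (1.1) and (1.3)")] -/
theorem shift_cfun_eq (A κ : ℂ) (ω : ℝ) (hκ : κ ≠ 0) (h₁ : κ - ω ≠ 0) (h₂ : -κ - ω ≠ 0)
    (t : ℝ) :
    cexp (-((ω : ℂ) * t)) * (A * ((Complex.cosh (κ * t) - 1) / κ ^ 2)) +
        2 * (ω : ℂ) * (∫ u in (0 : ℝ)..t,
          cexp (-((ω : ℂ) * u)) * (A * ((Complex.cosh (κ * u) - 1) / κ ^ 2))) +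
        (ω : ℂ) ^ 2 * ∫ u in (0 : ℝ)..t,
          ((t : ℂ) - u) * (cexp (-((ω : ℂ) * u)) * (A * ((Complex.cosh (κ * u) - 1) / κ ^ 2))) =
      A * ((cexp ((κ - ω) * t) - 1 - (κ - ω) * t) / (κ - ω) ^ 2 / 2 +
        (cexp ((-κ - ω) * t) - 1 - (-κ - ω) * t) / (-κ - ω) ^ 2 / 2) := by
  -- the data of the ODE argument
  have hk : ∀ u : ℝ, HasDerivAt (fun s : ℝ ↦ A * ((Complex.cosh (κ * s) - 1) / κ ^ 2))
      (A * (Complex.sinh (κ * u) * κ / κ ^ 2)) u := fun u ↦ (hasDerivAt_cfun κ u).const_mul A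
  have hk' : ∀ u : ℝ, HasDerivAt (fun s : ℝ ↦ A * (Complex.sinh (κ * s) * κ / κ ^ 2))
      (A * Complex.cosh (κ * u)) u := fun u ↦ (hasDerivAt_cfun_deriv hκ u).const_mul A
  have hkc : Continuous fun s : ℝ ↦ A * ((Complex.cosh (κ * s) - 1) / κ ^ 2) :=
    continuous_const.mul (((Complex.continuous_cosh.comp
      (continuous_const.mul continuous_ofReal)).sub continuous_const).div_const _)
  have hg : ∀ s : ℝ, HasDerivAt (fun s : ℝ ↦ A * ((cexp ((κ - ω) * s) - 1 - (κ - ω) * s) / (κ - ω) ^ 2 / 2 +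
        (cexp ((-κ - ω) * s) - 1 - (-κ - ω) * s) / (-κ - ω) ^ 2 / 2))
      (A * ((cexp ((κ - ω) * s) - 1) / (κ - ω) / 2 + (cexp ((-κ - ω) * s) - 1) / (-κ - ω) / 2)) s :=
    fun s ↦ (((hasDerivAt_hfun h₁ s).div_const 2).fun_add
      ((hasDerivAt_hfun h₂ s).div_const 2)).const_mul A
  have hg' : ∀ s : ℝ, HasDerivAt
      (fun s : ℝ ↦ A * ((cexp ((κ - ω) * s) - 1) / (κ - ω) / 2 + (cexp ((-κ - ω) * s) - 1) / (-κ - ω) / 2))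
      (A * (cexp ((κ - ω) * s) / 2 + cexp ((-κ - ω) * s) / 2)) s :=
    fun s ↦ (((hasDerivAt_hfun_deriv h₁ s).div_const 2).fun_add
      ((hasDerivAt_hfun_deriv h₂ s).div_const 2)).const_mul A
  refine eq_of_hasDerivAt_two (fun s ↦ hasDerivAt_shift hk hkc s)
    (fun s ↦ hasDerivAt_shift_deriv hk hk' hkc s) hg hg' ?_ ?_ ?_ t
  · intro s
    show cexp (-((ω : ℂ) * s)) * (A * Complex.cosh (κ * s)) =
      A * (cexp ((κ - ω) * s) / 2 + cexp ((-κ - ω) * s) / 2)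
    rw [mul_left_comm, cexp_neg_mul_cosh]
  · simp
  · simp

/-! ## §B. Positivity of `Re h(α,t)` for `Re α ≤ 0` (Pólya's mechanism) -/

/-- `conj h(α,t) = h(conj α, t)`. [folklore] -/
private theorem conj_hfun (α : ℂ) (t : ℝ) :
    conj ((cexp (α * t) - 1 - α * t) / α ^ 2) =
      (cexp (conj α * t) - 1 - conj α * t) / (conj α) ^ 2 := by
  simp only [map_div₀, map_sub, map_mul, map_pow, map_one, Complex.conj_ofReal,
    ← Complex.exp_conj]

/-- `c(iτ, u) = (cosh(iτu) − 1)/(iτ)² = (1 − cos τu)/τ²`, a non-negative real. [folklore] -/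
private theorem cfun_imaginary (τ u : ℝ) :
    (Complex.cosh ((τ : ℂ) * I * u) - 1) / ((τ : ℂ) * I) ^ 2 =
      (((1 - Real.cos (τ * u)) / τ ^ 2 : ℝ) : ℂ) := by
  rw [show (τ : ℂ) * I * u = ((τ * u : ℝ) : ℂ) * I by push_cast; ring, Complex.cosh_mul_I,
    ← Complex.ofReal_cos, mul_pow, Complex.I_sq]
  push_cast
  rcases eq_or_ne τ 0 with hτ | hτ
  · subst hτ; simp
  · have : (τ : ℂ) ≠ 0 := by exact_mod_cast hτ
    field_simp
    ring

/-- **`Re h(α,t) ≥ 0`** for `Re α ≤ 0`, `Im α ≠ 0`, `t ≥ 0`, where `h(α,t) = (e^{αt} − 1 − αt)/α²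
= ∫₀ᵗ(t−u)e^{αu}du` (Pólya: `(t−u)⁺e^{(Re α)u}` is convex and decreasing).  Proof by the shift
identity `shift_cfun_eq` at `κ = i Im α`, `ω = −Re α`:
`Re h(α,t) = e^{−δt}c(t) + 2δ∫₀ᵗe^{−δu}c(u)du + δ²∫₀ᵗ(t−u)e^{−δu}c(u)du`, `δ = −Re α ≥ 0`,
`c(u) = (1 − cos(Im α·u))/(Im α)² ≥ 0`. [folklore] -/
private theorem re_hfun_nonneg {α : ℂ} (hre : α.re ≤ 0) (him : α.im ≠ 0) {t : ℝ} (ht : 0 ≤ t) :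
    0 ≤ ((cexp (α * t) - 1 - α * t) / α ^ 2).re := by
  set δ : ℝ := -α.re with hδ
  set τ : ℝ := α.im with hτ
  have hδ0 : 0 ≤ δ := by rw [hδ]; linarith
  have hκ : (τ : ℂ) * I ≠ 0 := mul_ne_zero (by exact_mod_cast him) Complex.I_ne_zero
  have hα : (τ : ℂ) * I - (δ : ℂ) = α := by
    apply Complex.ext <;> simp [hδ, hτ]
  have hαc : -((τ : ℂ) * I) - (δ : ℂ) = conj α := by
    apply Complex.ext <;> simp [hδ, hτ]
  have hα0 : α ≠ 0 := by
    intro h; apply him; rw [hτ, h, Complex.zero_im]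
  have h₁ : (τ : ℂ) * I - (δ : ℂ) ≠ 0 := by rwa [hα]
  have h₂ : -((τ : ℂ) * I) - (δ : ℂ) ≠ 0 := by
    rw [hαc]; exact (map_ne_zero_iff _ (RingHom.injective _)).2 hα0
  have key := shift_cfun_eq 1 ((τ : ℂ) * I) δ hκ h₁ h₂ t
  rw [hα, hαc, one_mul, ← conj_hfun, ← add_div, Complex.add_conj] at key
  -- the left-hand side is (the cast of) a non-negative real
  set r : ℝ → ℝ := fun u ↦ (1 - Real.cos (τ * u)) / τ ^ 2 with hr
  have hr0 : ∀ u, 0 ≤ r u := fun u ↦ div_nonneg (sub_nonneg.2 (Real.cos_le_one _)) (sq_nonneg _)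
  have hc : ∀ u : ℝ, (Complex.cosh ((τ : ℂ) * I * u) - 1) / ((τ : ℂ) * I) ^ 2 = ((r u : ℝ) : ℂ) :=
    fun u ↦ cfun_imaginary τ u
  have hE : ∀ u : ℝ, cexp (-((δ : ℂ) * u)) = ((Real.exp (-(δ * u)) : ℝ) : ℂ) := by
    intro u; push_cast; rfl
  simp only [one_mul, hc, hE] at key
  have hI1 : ∫ u in (0 : ℝ)..t, ((Real.exp (-(δ * u)) : ℝ) : ℂ) * ((r u : ℝ) : ℂ) =
      ((∫ u in (0 : ℝ)..t, Real.exp (-(δ * u)) * r u : ℝ) : ℂ) := by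
    rw [← intervalIntegral.integral_ofReal]
    exact intervalIntegral.integral_congr fun u _ ↦ by push_cast; ring
  have hI2 : ∫ u in (0 : ℝ)..t, ((t : ℂ) - u) * (((Real.exp (-(δ * u)) : ℝ) : ℂ) * ((r u : ℝ) : ℂ)) =
      ((∫ u in (0 : ℝ)..t, (t - u) * (Real.exp (-(δ * u)) * r u) : ℝ) : ℂ) := by
    rw [← intervalIntegral.integral_ofReal]
    exact intervalIntegral.integral_congr fun u _ ↦ by push_cast; ring
  have e2 : (((2 * ((cexp (α * t) - 1 - α * t) / α ^ 2).re : ℝ)) : ℂ) / 2 =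
      ((((cexp (α * t) - 1 - α * t) / α ^ 2).re : ℝ) : ℂ) := by
    push_cast; ring
  rw [hI1, hI2, e2] at key
  have hre : ((cexp (α * t) - 1 - α * t) / α ^ 2).re =
      Real.exp (-(δ * t)) * r t + 2 * δ * (∫ u in (0 : ℝ)..t, Real.exp (-(δ * u)) * r u) +
        δ ^ 2 * ∫ u in (0 : ℝ)..t, (t - u) * (Real.exp (-(δ * u)) * r u) := by
    exact_mod_cast key.symm
  rw [hre]
  have hJ1 : 0 ≤ ∫ u in (0 : ℝ)..t, Real.exp (-(δ * u)) * r u :=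
    intervalIntegral.integral_nonneg ht fun u _ ↦ mul_nonneg (Real.exp_pos _).le (hr0 u)
  have hJ2 : 0 ≤ ∫ u in (0 : ℝ)..t, (t - u) * (Real.exp (-(δ * u)) * r u) :=
    intervalIntegral.integral_nonneg ht fun u hu ↦
      mul_nonneg (by linarith [hu.2]) (mul_nonneg (Real.exp_pos _).le (hr0 u))
  have h0 : 0 ≤ Real.exp (-(δ * t)) * r t := mul_nonneg (Real.exp_pos _).le (hr0 t)
  positivity

/-! ## §C. The zero series of `Ψ_ω(t)` (Suzuki2023, p. 22) -/

/-- `‖cosh(κu) − 1‖ ≤ cosh(t/2) + 1` for `|Re κ| ≤ 1/2`, `|u| ≤ t`. [folklore] -/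
private theorem norm_cosh_sub_one_le {κ : ℂ} (hκ : |κ.re| ≤ 1 / 2) {u t : ℝ} (hu : |u| ≤ t) :
    ‖Complex.cosh (κ * u) - 1‖ ≤ Real.cosh (t / 2) + 1 := by
  have ht : 0 ≤ t := (abs_nonneg u).trans hu
  have h1 : ‖Complex.cosh (κ * u)‖ ≤ Real.cosh ((κ * u).re) := by
    rw [Complex.cosh, Real.cosh_eq, norm_div, Complex.norm_ofNat]
    gcongr
    calc ‖cexp (κ * u) + cexp (-(κ * u))‖
        ≤ ‖cexp (κ * u)‖ + ‖cexp (-(κ * u))‖ := norm_add_le _ _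
      _ = Real.exp ((κ * u).re) + Real.exp (-(κ * u).re) := by
          rw [Complex.norm_exp, Complex.norm_exp, neg_re]
  have h2 : Real.cosh ((κ * u).re) ≤ Real.cosh (t / 2) := by
    rw [Real.cosh_le_cosh, Complex.re_mul_ofReal, abs_mul, abs_of_nonneg (by linarith : 0 ≤ t / 2)]
    nlinarith [abs_nonneg κ.re, abs_nonneg u]
  calc ‖Complex.cosh (κ * u) - 1‖ ≤ ‖Complex.cosh (κ * u)‖ + ‖(1 : ℂ)‖ := norm_sub_le _ _
    _ ≤ Real.cosh (t / 2) + 1 := by rw [norm_one]; gcongr; exact h1.trans h2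

/-- For a non-trivial zero, `|Re(ρ − 1/2)| ≤ 1/2`. [folklore] -/
private theorem abs_re_sub_half_le (ρ : ZetaZeros.riemannZetaNontrivialZeros) :
    |((ρ : ℂ) - 1 / 2).re| ≤ 1 / 2 := by
  have h0 := ZetaZeros.riemannZetaNontrivialZeros.re_pos ρ.2
  have h1 := ZetaZeros.riemannZetaNontrivialZeros.re_lt_one ρ.2
  have e : ((ρ : ℂ) - 1 / 2).re = (ρ : ℂ).re - 1 / 2 := by simp
  rw [e, abs_le]; constructor <;> linarith

/-- For a non-trivial zero, `(Im ρ)² ≤ ‖ρ − 1/2‖²` and `Im ρ ≠ 0`; in particular `ρ − 1/2 ≠ 0`.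
[folklore] -/
private theorem im_sq_le_norm_sub_half_sq (ρ : ZetaZeros.riemannZetaNontrivialZeros) :
    (ρ : ℂ).im ^ 2 ≤ ‖(ρ : ℂ) - 1 / 2‖ ^ 2 := by
  have h := Complex.abs_im_le_norm ((ρ : ℂ) - 1 / 2)
  have e : ((ρ : ℂ) - 1 / 2).im = (ρ : ℂ).im := by simp
  rw [e] at h
  nlinarith [abs_nonneg ((ρ : ℂ).im), sq_abs ((ρ : ℂ).im), norm_nonneg ((ρ : ℂ) - 1 / 2)]

/-- `(Im ρ)² > 0` for a non-trivial zero (`|Im ρ| > 14`). [folklore] -/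
private theorem im_sq_pos (ρ : ZetaZeros.riemannZetaNontrivialZeros) : 0 < (ρ : ℂ).im ^ 2 := by
  have h := FordL33.fourteen_lt_abs_im ρ
  nlinarith [abs_nonneg ((ρ : ℂ).im), sq_abs ((ρ : ℂ).im)]

/-- `ρ − 1/2 ≠ 0` for a non-trivial zero. [folklore] -/
private theorem sub_half_ne_zero (ρ : ZetaZeros.riemannZetaNontrivialZeros) : (ρ : ℂ) - 1 / 2 ≠ 0 := by
  intro h
  have := im_sq_le_norm_sub_half_sq ρ
  rw [h, norm_zero] at this
  linarith [im_sq_pos ρ]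

/-- `Σ_ρ m(ρ)/‖ρ − 1/2‖² < ∞` (from the tree's `Σ 2m(ρ)/(Im ρ)² < ∞`, Jensen/Titchmarsh Thm 9.2).
[cite: Titchmarsh1986, §9.2, Thm. 9.2] -/
private theorem summable_order_div_norm_sub_half_sq :
    Summable fun ρ : ZetaZeros.riemannZetaNontrivialZeros ↦
      (riemannZetaZeroOrder (ρ : ℂ) : ℝ) / ‖(ρ : ℂ) - 1 / 2‖ ^ 2 := by
  refine Summable.of_nonneg_of_le (fun ρ ↦ div_nonneg (FordL33.order_pos ρ).le (sq_nonneg _))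
    (fun ρ ↦ ?_) ZetaScrewGrowth.summable_two_mul_order_div_im_sq
  have hm := (FordL33.order_pos ρ).le
  have him := im_sq_pos ρ
  calc (riemannZetaZeroOrder (ρ : ℂ) : ℝ) / ‖(ρ : ℂ) - 1 / 2‖ ^ 2
      ≤ (riemannZetaZeroOrder (ρ : ℂ) : ℝ) / (ρ : ℂ).im ^ 2 :=
        div_le_div_of_nonneg_left hm him (im_sq_le_norm_sub_half_sq ρ)
    _ ≤ 2 * (riemannZetaZeroOrder (ρ : ℂ) : ℝ) / (ρ : ℂ).im ^ 2 := by
        rw [mul_div_assoc]; linarith [div_nonneg hm him.le]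

/-- `‖e^{−ωu}‖ ≤ e^{|ω|t}` for `0 ≤ u ≤ t`. [folklore] -/
private theorem norm_cexp_neg_mul_le (ω : ℝ) {u t : ℝ} (hu : u ∈ Icc 0 t) :
    ‖cexp (-((ω : ℂ) * u))‖ ≤ Real.exp (|ω| * t) := by
  rw [Complex.norm_exp, Real.exp_le_exp]
  have e : (-((ω : ℂ) * u)).re = -(ω * u) := by simp
  rw [e]
  calc -(ω * u) ≤ |ω * u| := neg_le_abs _
    _ = |ω| * u := by rw [abs_mul, abs_of_nonneg hu.1]
    _ ≤ |ω| * t := by gcongr; exact hu.2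

/-- The termwise bound on `[0, t]`: `‖e^{−ωu} m(ρ)c_ρ(u)‖ ≤ e^{|ω|t}(cosh(t/2)+1)·m(ρ)/‖ρ − 1/2‖²`.
[folklore] -/
private theorem norm_term_le (ω : ℝ) {u t : ℝ} (hu : u ∈ Icc 0 t)
    (ρ : ZetaZeros.riemannZetaNontrivialZeros) :
    ‖cexp (-((ω : ℂ) * u)) * ((riemannZetaZeroOrder (ρ : ℂ) : ℂ) *
        ((Complex.cosh (((ρ : ℂ) - 1 / 2) * u) - 1) / ((ρ : ℂ) - 1 / 2) ^ 2))‖ ≤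
      Real.exp (|ω| * t) * (Real.cosh (t / 2) + 1) *
        ((riemannZetaZeroOrder (ρ : ℂ) : ℝ) / ‖(ρ : ℂ) - 1 / 2‖ ^ 2) := by
  have hm : (0 : ℝ) ≤ riemannZetaZeroOrder (ρ : ℂ) := (FordL33.order_pos ρ).le
  rw [norm_mul, norm_mul, norm_div, norm_pow, Complex.norm_intCast, abs_of_nonneg hm]
  have hE := norm_cexp_neg_mul_le ω hu
  have hc := norm_cosh_sub_one_le (abs_re_sub_half_le ρ)
    (show |u| ≤ t by rw [abs_of_nonneg hu.1]; exact hu.2)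
  calc ‖cexp (-((ω : ℂ) * u))‖ * ((riemannZetaZeroOrder (ρ : ℂ) : ℝ) *
        (‖Complex.cosh (((ρ : ℂ) - 1 / 2) * u) - 1‖ / ‖(ρ : ℂ) - 1 / 2‖ ^ 2))
      ≤ Real.exp (|ω| * t) * ((riemannZetaZeroOrder (ρ : ℂ) : ℝ) *
        ((Real.cosh (t / 2) + 1) / ‖(ρ : ℂ) - 1 / 2‖ ^ 2)) := by gcongr
    _ = _ := by ring

/-- **The zero series of `Ψ_ω(t)`** (`t > 0`; Suzuki2023 p. 22, "the analogs of (1.1) and (1.3)",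
here in the unsimplified form obtained by pushing Thm 1.1 (2) through (11.1) termwise):
`Ψ_ω(t) = Σ_ρ [e^{−ωt}k_ρ(t) + 2ω∫₀ᵗe^{−ωu}k_ρ(u)du + ω²∫₀ᵗ(t−u)e^{−ωu}k_ρ(u)du]`,
`k_ρ(u) = m(ρ)(cosh((ρ−1/2)u) − 1)/(ρ−1/2)²` (dominated convergence on `[0,t]`, majorant
`e^{|ω|t}(cosh(t/2)+1)m(ρ)/|ρ−1/2|²`). [cite: Suzuki2023, §11, p. 22 (arXiv p0022:L57–66)] -/
theorem hasSum_zetaScrewShift (ω : ℝ) {t : ℝ} (ht : 0 < t) :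
    HasSum (fun ρ : ZetaZeros.riemannZetaNontrivialZeros ↦
      cexp (-((ω : ℂ) * t)) * ((riemannZetaZeroOrder (ρ : ℂ) : ℂ) *
          ((Complex.cosh (((ρ : ℂ) - 1 / 2) * t) - 1) / ((ρ : ℂ) - 1 / 2) ^ 2)) +
        2 * (ω : ℂ) * (∫ u in (0 : ℝ)..t, cexp (-((ω : ℂ) * u)) *
          ((riemannZetaZeroOrder (ρ : ℂ) : ℂ) *
            ((Complex.cosh (((ρ : ℂ) - 1 / 2) * u) - 1) / ((ρ : ℂ) - 1 / 2) ^ 2))) +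
        (ω : ℂ) ^ 2 * ∫ u in (0 : ℝ)..t, ((t : ℂ) - u) * (cexp (-((ω : ℂ) * u)) *
          ((riemannZetaZeroOrder (ρ : ℂ) : ℂ) *
            ((Complex.cosh (((ρ : ℂ) - 1 / 2) * u) - 1) / ((ρ : ℂ) - 1 / 2) ^ 2))))
      (zetaScrewShift ω t : ℂ) := by
  haveI : Countable ZetaZeros.riemannZetaNontrivialZeros :=
    riemannZetaNontrivialZeros_countable.to_subtype
  have hΨ : ∀ s : ℝ, HasSum (fun ρ : ZetaZeros.riemannZetaNontrivialZeros ↦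
      (riemannZetaZeroOrder (ρ : ℂ) : ℂ) *
        ((Complex.cosh (((ρ : ℂ) - 1 / 2) * s) - 1) / ((ρ : ℂ) - 1 / 2) ^ 2)) (zetaScrew s : ℂ) :=
    Suzuki2023_thm11_series_holds
  have hsum := summable_order_div_norm_sub_half_sq
  have hcont : ∀ ρ : ZetaZeros.riemannZetaNontrivialZeros, Continuous fun u : ℝ ↦
      cexp (-((ω : ℂ) * u)) * ((riemannZetaZeroOrder (ρ : ℂ) : ℂ) *
        ((Complex.cosh (((ρ : ℂ) - 1 / 2) * u) - 1) / ((ρ : ℂ) - 1 / 2) ^ 2)) := by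
    intro ρ
    exact continuous_cexp_neg_mul_mul (continuous_const.mul
      (((Complex.continuous_cosh.comp (continuous_const.mul continuous_ofReal)).sub
        continuous_const).div_const _))
  have hcont3 : ∀ ρ : ZetaZeros.riemannZetaNontrivialZeros, Continuous fun u : ℝ ↦
      ((t : ℂ) - u) * (cexp (-((ω : ℂ) * u)) * ((riemannZetaZeroOrder (ρ : ℂ) : ℂ) *
        ((Complex.cosh (((ρ : ℂ) - 1 / 2) * u) - 1) / ((ρ : ℂ) - 1 / 2) ^ 2))) := by
    intro ρ
    have h1 : Continuous fun u : ℝ ↦ (t : ℂ) - u := continuous_const.sub continuous_ofReal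
    exact h1.mul (hcont ρ)
  -- the three parts of (11.1)
  have p1 := (hΨ t).mul_left (cexp (-((ω : ℂ) * t)))
  have p2 : HasSum (fun ρ : ZetaZeros.riemannZetaNontrivialZeros ↦ ∫ u in (0 : ℝ)..t,
      cexp (-((ω : ℂ) * u)) * ((riemannZetaZeroOrder (ρ : ℂ) : ℂ) *
        ((Complex.cosh (((ρ : ℂ) - 1 / 2) * u) - 1) / ((ρ : ℂ) - 1 / 2) ^ 2)))
      (∫ u in (0 : ℝ)..t, cexp (-((ω : ℂ) * u)) * (zetaScrew u : ℂ)) := by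
    refine intervalIntegral.hasSum_integral_of_dominated_convergence
      (fun ρ _ ↦ Real.exp (|ω| * t) * (Real.cosh (t / 2) + 1) *
        ((riemannZetaZeroOrder (ρ : ℂ) : ℝ) / ‖(ρ : ℂ) - 1 / 2‖ ^ 2))
      (fun ρ ↦ (hcont ρ).aestronglyMeasurable) (fun ρ ↦ ae_of_all _ fun u hu ↦ ?_)
      (ae_of_all _ fun u _ ↦ hsum.mul_left _) intervalIntegrable_const
      (ae_of_all _ fun u _ ↦ (hΨ u).mul_left (cexp (-((ω : ℂ) * u))))
    rw [uIoc_of_le ht.le] at hu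
    exact norm_term_le ω ⟨hu.1.le, hu.2⟩ ρ
  have p3 : HasSum (fun ρ : ZetaZeros.riemannZetaNontrivialZeros ↦ ∫ u in (0 : ℝ)..t,
      ((t : ℂ) - u) * (cexp (-((ω : ℂ) * u)) * ((riemannZetaZeroOrder (ρ : ℂ) : ℂ) *
        ((Complex.cosh (((ρ : ℂ) - 1 / 2) * u) - 1) / ((ρ : ℂ) - 1 / 2) ^ 2))))
      (∫ u in (0 : ℝ)..t, ((t : ℂ) - u) * (cexp (-((ω : ℂ) * u)) * (zetaScrew u : ℂ))) := by
    refine intervalIntegral.hasSum_integral_of_dominated_convergence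
      (fun ρ _ ↦ t * (Real.exp (|ω| * t) * (Real.cosh (t / 2) + 1)) *
        ((riemannZetaZeroOrder (ρ : ℂ) : ℝ) / ‖(ρ : ℂ) - 1 / 2‖ ^ 2))
      (fun ρ ↦ (hcont3 ρ).aestronglyMeasurable)
      (fun ρ ↦ ae_of_all _ fun u hu ↦ ?_)
      (ae_of_all _ fun u _ ↦ hsum.mul_left _) intervalIntegrable_const
      (ae_of_all _ fun u _ ↦
        ((hΨ u).mul_left (cexp (-((ω : ℂ) * u)))).mul_left ((t : ℂ) - u))
    rw [uIoc_of_le ht.le] at hu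
    rw [norm_mul]
    have h1 : ‖((t : ℂ) - u)‖ ≤ t := by
      rw [show ((t : ℂ) - u) = ((t - u : ℝ) : ℂ) by push_cast; ring, Complex.norm_real,
        Real.norm_eq_abs, abs_of_nonneg (by linarith [hu.2])]
      linarith [hu.1]
    have h2 := norm_term_le ω ⟨hu.1.le, hu.2⟩ ρ
    calc _ ≤ t * (Real.exp (|ω| * t) * (Real.cosh (t / 2) + 1) *
          ((riemannZetaZeroOrder (ρ : ℂ) : ℝ) / ‖(ρ : ℂ) - 1 / 2‖ ^ 2)) :=
        mul_le_mul h1 h2 (norm_nonneg _) ht.le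
      _ = _ := by ring
  have h := (p1.add (p2.mul_left (2 * (ω : ℂ)))).add (p3.mul_left ((ω : ℂ) ^ 2))
  have hval : (zetaScrewShift ω t : ℂ) = cexp (-((ω : ℂ) * t)) * (zetaScrew t : ℂ) +
      2 * (ω : ℂ) * (∫ u in (0 : ℝ)..t, cexp (-((ω : ℂ) * u)) * (zetaScrew u : ℂ)) +
      (ω : ℂ) ^ 2 * ∫ u in (0 : ℝ)..t, ((t : ℂ) - u) * (cexp (-((ω : ℂ) * u)) * (zetaScrew u : ℂ)) := by
    rw [ZetaScrewShiftLaplace.zetaScrewShift_ofReal_of_pos ω ht]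
    push_cast
    rfl
  rw [hval]
  exact h

/-! ## §D. Thm 11.1 `⟹` (for every `t`) and the discharge -/

/-- A non-trivial zero of `ζ` is a zero of `ξ`. [cite: Titchmarsh1986, §2.12] -/
private theorem riemannXi_eq_zero_of_mem (ρ : ZetaZeros.riemannZetaNontrivialZeros) :
    riemannXi (ρ : ℂ) = 0 := by
  have h := ZetaZeros.riemannZetaNontrivialZeros.mem_iff'.1 ρ.2
  refine riemannXi_eq_zero_of_nontrivial h.1 ?_ (ZetaZeros.riemannZetaNontrivialZeros.ne_one ρ.2)
  rintro ⟨n, hn⟩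
  have h0 := h.2.1
  rw [hn] at h0
  simp at h0
  linarith

/-- Under "`ξ(s) ≠ 0` for `Re s > 1/2 + ω`" every non-trivial zero satisfies
`1/2 − ω ≤ Re ρ ≤ 1/2 + ω` (the hypothesis at `ρ` and at `1 − ρ`). [cite: Suzuki2023, §11, p. 22] -/
private theorem re_bounds_of_riemannXi_ne_zero {ω : ℝ}
    (hξ : ∀ s : ℂ, 1 / 2 + ω < s.re → riemannXi s ≠ 0)
    (ρ : ZetaZeros.riemannZetaNontrivialZeros) :
    (ρ : ℂ).re ≤ 1 / 2 + ω ∧ 1 / 2 - ω ≤ (ρ : ℂ).re := by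
  constructor
  · by_contra h
    exact hξ _ (not_le.1 h) (riemannXi_eq_zero_of_mem ρ)
  · have h1 : 1 - (ρ : ℂ) ∈ ZetaZeros.riemannZetaNontrivialZeros := by
      have := ZetaZeros.riemannZetaNontrivialZeros.conj_mem
        (ZetaZeros.riemannZetaNontrivialZeros.one_sub_conj_mem ρ.2)
      simpa using this
    by_contra h
    have h2 : 1 / 2 + ω < (1 - (ρ : ℂ)).re := by
      simp only [sub_re, one_re]
      linarith [not_le.1 h]
    exact hξ _ h2 (riemannXi_eq_zero_of_mem ⟨_, h1⟩)

/-- **Suzuki2023 Thm 11.1, direction `⟹`, for every `t`**: if `ξ(s) ≠ 0` for `Re s > 1/2 + ω`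
then `Ψ_ω(t) ≥ 0` for all real `t` (printed, p. 22: "if `ξ(s) ≠ 0` for `Re(s) > 1/2 + ω`, the
function `Ψ_ω(t)` is non-negative"; the source argues via `𝒩` and [KrLa77], here via the zero
series `hasSum_zetaScrewShift`, the shift identity `shift_cfun_eq` and `re_hfun_nonneg`).
[cite: Suzuki2023, §11 and Thm 11.1, p. 22 (arXiv p0022:L37–52)] -/
theorem zetaScrewShift_nonneg_of_riemannXi_ne_zero {ω : ℝ}
    (hξ : ∀ s : ℂ, 1 / 2 + ω < s.re → riemannXi s ≠ 0) (t : ℝ) : 0 ≤ zetaScrewShift ω t := by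
  wlog ht : 0 < t generalizing t
  · rcases eq_or_lt_of_le (not_lt.1 ht) with h0 | hneg
    · rw [h0, zetaScrewShift_zero_right]
    · rw [← zetaScrewShift_neg]
      exact this (-t) (by linarith)
  have hS := hasSum_zetaScrewShift ω ht
  -- each term is `m(ρ)·½[h(κ−ω,t) + h(−κ−ω,t)]`, `κ = ρ − 1/2`
  have him : ∀ ρ : ZetaZeros.riemannZetaNontrivialZeros, (ρ : ℂ).im ≠ 0 := fun ρ h ↦ by
    have := FordL33.fourteen_lt_abs_im ρ
    rw [h, abs_zero] at this
    linarith
  have h₁ : ∀ ρ : ZetaZeros.riemannZetaNontrivialZeros, (ρ : ℂ) - 1 / 2 - (ω : ℂ) ≠ 0 :=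
    fun ρ h ↦ him ρ (by simpa using congrArg Complex.im h)
  have h₂ : ∀ ρ : ZetaZeros.riemannZetaNontrivialZeros, -((ρ : ℂ) - 1 / 2) - (ω : ℂ) ≠ 0 :=
    fun ρ h ↦ him ρ (by simpa using congrArg Complex.im h)
  have e := funext fun ρ : ZetaZeros.riemannZetaNontrivialZeros ↦
    shift_cfun_eq (riemannZetaZeroOrder (ρ : ℂ) : ℂ) ((ρ : ℂ) - 1 / 2) ω (sub_half_ne_zero ρ)
      (h₁ ρ) (h₂ ρ) t
  rw [e] at hS
  have hR := Complex.hasSum_re hS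
  rw [Complex.ofReal_re] at hR
  refine hR.nonneg fun ρ ↦ ?_
  have hb := re_bounds_of_riemannXi_ne_zero hξ ρ
  have hm : (0 : ℝ) ≤ riemannZetaZeroOrder (ρ : ℂ) := (FordL33.order_pos ρ).le
  have hA : 0 ≤ ((cexp (((ρ : ℂ) - 1 / 2 - ω) * t) - 1 - ((ρ : ℂ) - 1 / 2 - ω) * t) /
      ((ρ : ℂ) - 1 / 2 - ω) ^ 2).re :=
    re_hfun_nonneg (by simp; linarith [hb.1]) (by simpa using him ρ) ht.le
  have hB : 0 ≤ ((cexp ((-((ρ : ℂ) - 1 / 2) - ω) * t) - 1 - (-((ρ : ℂ) - 1 / 2) - ω) * t) /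
      (-((ρ : ℂ) - 1 / 2) - ω) ^ 2).re :=
    re_hfun_nonneg (by simp; linarith [hb.2]) (by simpa using him ρ) ht.le
  rw [← Complex.ofReal_intCast, Complex.re_ofReal_mul, Complex.add_re, Complex.div_ofNat_re,
    Complex.div_ofNat_re]
  positivity

end Suzuki2023Thm111

/-- **Suzuki2023 Thm 11.1, `⟹`**: `ξ(s) ≠ 0` for `Re s > 1/2 + ω` implies that `Ψ_ω(t)` is
eventually non-negative (indeed non-negative for every `t`,
`Suzuki2023Thm111.zetaScrewShift_nonneg_of_riemannXi_ne_zero`). [cite: Suzuki2023, Thm 11.1, p. 22] -/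
theorem Suzuki2023_thm111_mp (ω : ℝ) (hξ : ∀ s : ℂ, 1 / 2 + ω < s.re → riemannXi s ≠ 0) :
    ∃ t₀ : ℝ, 0 < t₀ ∧ ∀ t : ℝ, t₀ ≤ t → 0 ≤ zetaScrewShift ω t :=
  ⟨1, one_pos, fun t _ ↦ Suzuki2023Thm111.zetaScrewShift_nonneg_of_riemannXi_ne_zero hξ t⟩

/-- **Discharge of `Suzuki2023_thm111`** (Suzuki2023 Thm 11.1, both directions, every real `ω`):
"`ξ(s) ≠ 0` for `Re(s) > 1/2 + ω` if and only if there exists `t₀ > 0` such that `Ψ_ω(t)` is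
non-negative when `t ≥ t₀`" (`⟹`: `Suzuki2023_thm111_mp`; `⟸`: `Suzuki2023_thm111_mpr`,
`ZetaScrewGrowthMomentsProofs.lean`). [cite: Suzuki2023, Thm 11.1, p. 22 (arXiv p0022:L48–52)] -/
theorem Suzuki2023_thm111_holds : Suzuki2023_thm111 :=
  fun ω ↦ ⟨Suzuki2023_thm111_mp ω, Suzuki2023_thm111_mpr ω⟩

/-- The unconditional rung, now a theorem (p. 22: "`Ψ_ω(t) ≥ 0` unconditionally if `ω ≥ 1/2`,
because it is well-known that `ξ(s) ≠ 0` for `Re(s) > 1`"): for `ω ≥ 1/2`, `Ψ_ω(t) ≥ 0` for every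
real `t`. [cite: Suzuki2023, §11, p. 22 (arXiv p0022:L54–56)] -/
theorem zetaScrewShift_nonneg_of_half_le {ω : ℝ} (hω : 1 / 2 ≤ ω) (t : ℝ) :
    0 ≤ zetaScrewShift ω t :=
  Suzuki2023Thm111.zetaScrewShift_nonneg_of_riemannXi_ne_zero
    (fun s hs ↦ riemannXi_ne_zero_of_one_le_re (by linarith)) t


end Literature.NumberTheory.LFunctions
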